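import Summits.Ventures.LatticeQCDFlow.Scoring.MadrasSokalWindow

/-!
# Scorer B's `ms_window` as a total, measurable selector: the first crossing `W ≥ c τ̂_W` on `1 ≤ W ≤ W_max`, else `W_max`

HONEST FRAMING: exact (Metropolis-corrected) sampling algorithms for lattice gauge theory;
figures of merit are autocorrelation/cost numbers at stated couplings and volumes; no
continuum-physics claim.

Venture `LatticeQCDFlow` (cell pub-lqcd), sub-topic `Scoring`; FANOUT row 16 (`su2-base`), GEN-8.
NEW WORK of the cell over row 11's `Scoring/MadrasSokalWindow` (`IsMSWindow`, `isMSWindow_unique`) and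
Mathlib (`Nat.find`, `measurable_find`); one definition (`msWindowSel`), nothing cited as a fact.
Printed counterpart NAMED ONLY: Madras–Sokal 1988 App. C (the self-consistent window).

WHY.  `Scoring/MadrasSokalDataWindow` (GEN-8) transfers fixed-window limit laws to a data-chosen
window `Ŵ_N` under two hypotheses on the selector: it is MEASURABLE and it RETURNS `w` WHENEVER `w` IS
THE Madras–Sokal window of the empirical curve.  THIS FILE types the selector both frozen scorers
actually run and proves both hypotheses for it.  Scorer B `scorer_b.py` `ms_window(rho, c)` l.139–146:
`tau(W) = 1/2 + Σ_{t=1}^{W} rho[t]` for `W = 1 … len(rho) − 1`, return the first `W` with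
`W ≥ c · tau(W)`, and `len(rho) − 1` (the last scanned window, `W_max`) if there is none; scorer A
`gamma.py` l.199–209 does the same per `c` of its scan with `W_max` and a `failed` flag.  As a total
function of ANY curve `τW : ℕ → ℝ`:

* `msWindowSel c Wmax τW = Nat.find (first W with (1 ≤ W ≤ Wmax ∧ c τW W ≤ W) ∨ W = Wmax)` — the
  disjunct `W = Wmax` makes the search total and IS the code's fallback;
* `msWindowSel_le` (`≤ Wmax`), `one_le_msWindowSel` (`1 ≤ ·` once `1 ≤ Wmax`: '`W = 0` never returned');
* **`msWindowSel_eq_of_isMSWindow`** — if `w` is THE MS window of the curve (`IsMSWindow c τW w`) and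
  `w ≤ Wmax`, the selector returns `w` (the `hsel` hypothesis of `MadrasSokalDataWindow`);
* **`isMSWindow_msWindowSel`** — conversely, if SOME crossing exists at `1 ≤ W ≤ Wmax`, the value
  returned IS the MS window of the curve; `msWindowSel_eq_of_forall_lt` — no crossing up to `Wmax` ⇒
  the fallback `Wmax` (scorer A's `failed` branch);
* **`measurable_msWindowSel`** — for a random curve `W ↦ τ̂_W(ω)` with measurable coordinates,
  `ω ↦ msWindowSel c Wmax (τ̂_·(ω))` is measurable (`measurable_find`; the events `{c τ̂_W ≤ W}`).

NOT CLAIMED: anything about the `(1 + (2W+1)/N)` correction scorer A applies AFTER choosing `W`, the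
bias or law of `τ̂` at the selected window (see `MadrasSokalDataWindow`), or the choice `c = 6`.
-/

noncomputable section

open MeasureTheory Filter Finset

namespace Summit.Ventures.LatticeQCDFlow.Scoring

/-! ## The selector -/

section Selector

/-- The search predicate of `ms_window`: a crossing at `W` within the scanned range, OR the fallback
`W = Wmax`. [ours] -/
def msCrossOrEnd (c : ℝ) (Wmax : ℕ) (τW : ℕ → ℝ) (W : ℕ) : Prop :=
  (1 ≤ W ∧ W ≤ Wmax ∧ c * τW W ≤ W) ∨ W = Wmax

/-- The search always terminates: `Wmax` satisfies the predicate. -/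
theorem exists_msCrossOrEnd (c : ℝ) (Wmax : ℕ) (τW : ℕ → ℝ) : ∃ W, msCrossOrEnd c Wmax τW W :=
  ⟨Wmax, Or.inr rfl⟩

open Classical in
/-- **Scorer B's `ms_window` (and scorer A's per-`c` scan), typed as a total function of the curve**:
the first `W` with `1 ≤ W ≤ Wmax` and `c · τW W ≤ W`, and `Wmax` if there is none
(scorer_b.py l.139–146; gamma.py l.199–209). [ours] -/
def msWindowSel (c : ℝ) (Wmax : ℕ) (τW : ℕ → ℝ) : ℕ :=
  Nat.find (exists_msCrossOrEnd c Wmax τW)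

open Classical in
/-- Unfolding: `msWindowSel` is the `Nat.find` of the search predicate. -/
theorem msWindowSel_eq_find (c : ℝ) (Wmax : ℕ) (τW : ℕ → ℝ) :
    msWindowSel c Wmax τW = Nat.find (exists_msCrossOrEnd c Wmax τW) := rfl

open Classical in
/-- The selector never exceeds the scanned range. -/
theorem msWindowSel_le (c : ℝ) (Wmax : ℕ) (τW : ℕ → ℝ) : msWindowSel c Wmax τW ≤ Wmax :=
  Nat.find_le (Or.inr rfl)

open Classical in
/-- '`W = 0` never returned': `1 ≤ msWindowSel` as soon as `1 ≤ Wmax`. -/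
theorem one_le_msWindowSel (c : ℝ) {Wmax : ℕ} (hW : 1 ≤ Wmax) (τW : ℕ → ℝ) :
    1 ≤ msWindowSel c Wmax τW := by
  rw [msWindowSel_eq_find, Nat.one_le_iff_ne_zero, Ne, Nat.find_eq_zero]
  rintro (⟨h1, -, -⟩ | h0)
  · exact absurd h1 (by norm_num)
  · omega

open Classical in
/-- **The selector returns THE Madras–Sokal window whenever it lies in the scanned range** (the `hsel`
hypothesis of `Scoring/MadrasSokalDataWindow`). -/
theorem msWindowSel_eq_of_isMSWindow {c : ℝ} {Wmax : ℕ} {τW : ℕ → ℝ} {w : ℕ}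
    (hw : IsMSWindow c τW w) (hle : w ≤ Wmax) : msWindowSel c Wmax τW = w := by
  rcases hw with ⟨h1, hcross, hbelow⟩
  rw [msWindowSel_eq_find, Nat.find_eq_iff]
  refine ⟨Or.inl ⟨h1, hle, hcross⟩, fun n hn hq => ?_⟩
  rcases hq with ⟨hn1, -, hncross⟩ | hnend
  · exact absurd hncross (not_le.2 (hbelow n hn1 hn))
  · omega

open Classical in
/-- **If some crossing exists in the scanned range, the value returned IS the Madras–Sokal window of
the curve.** -/
theorem isMSWindow_msWindowSel {c : ℝ} {Wmax : ℕ} {τW : ℕ → ℝ}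
    (h : ∃ W, 1 ≤ W ∧ W ≤ Wmax ∧ c * τW W ≤ W) : IsMSWindow c τW (msWindowSel c Wmax τW) := by
  obtain ⟨W₀, hW₀1, hW₀le, hW₀c⟩ := h
  have hspec : msCrossOrEnd c Wmax τW (msWindowSel c Wmax τW) := Nat.find_spec _
  have hmin : ∀ n < msWindowSel c Wmax τW, ¬ msCrossOrEnd c Wmax τW n := fun n hn =>
    Nat.find_min _ (by rwa [msWindowSel_eq_find] at hn)
  -- below the returned value there is no crossing
  have hbelow : ∀ W', 1 ≤ W' → W' < msWindowSel c Wmax τW → (W' : ℝ) < c * τW W' := by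
    intro W' h1 hlt
    have hle : W' ≤ Wmax := (hlt.le.trans (msWindowSel_le c Wmax τW))
    have hq := hmin W' hlt
    simp only [msCrossOrEnd, not_or, not_and, not_le] at hq
    exact hq.1 h1 hle
  rcases hspec with ⟨h1, -, hcross⟩ | hend
  · exact ⟨h1, hcross, hbelow⟩
  · -- the fallback value `Wmax` was returned: then the crossing `W₀ ≤ Wmax` must be `Wmax` itself
    have hW₀ : W₀ = Wmax := by
      by_contra hne
      have hlt : W₀ < msWindowSel c Wmax τW := by rw [hend]; omega
      exact absurd hW₀c (not_le.2 (hbelow W₀ hW₀1 hlt))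
    have h1 : 1 ≤ msWindowSel c Wmax τW := by rw [hend, ← hW₀]; exact hW₀1
    have hc : c * τW (msWindowSel c Wmax τW) ≤ (msWindowSel c Wmax τW : ℕ) := by
      rw [hend, ← hW₀]; exact hW₀c
    exact ⟨h1, hc, hbelow⟩

open Classical in
/-- **No crossing up to `Wmax` ⇒ the fallback `Wmax`** (scorer A's `failed` branch, scorer B's
`len(rho) − 1`). -/
theorem msWindowSel_eq_of_forall_lt {c : ℝ} {Wmax : ℕ} {τW : ℕ → ℝ}
    (h : ∀ W, 1 ≤ W → W ≤ Wmax → (W : ℝ) < c * τW W) : msWindowSel c Wmax τW = Wmax := by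
  rw [msWindowSel_eq_find, Nat.find_eq_iff]
  refine ⟨Or.inr rfl, fun n hn hq => ?_⟩
  rcases hq with ⟨hn1, hnle, hncross⟩ | hnend
  · exact absurd hncross (not_le.2 (h n hn1 hnle))
  · omega

/-- The value returned is either the MS window of the curve or the fallback (dichotomy). -/
theorem isMSWindow_msWindowSel_or_eq {c : ℝ} {Wmax : ℕ} {τW : ℕ → ℝ} :
    IsMSWindow c τW (msWindowSel c Wmax τW) ∨ msWindowSel c Wmax τW = Wmax := by
  by_cases h : ∃ W, 1 ≤ W ∧ W ≤ Wmax ∧ c * τW W ≤ W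
  · exact Or.inl (isMSWindow_msWindowSel h)
  · refine Or.inr (msWindowSel_eq_of_forall_lt fun W h1 hle => ?_)
    by_contra hge
    exact h ⟨W, h1, hle, not_lt.1 hge⟩

end Selector

/-! ## Measurability of the selector read on a random curve -/

section Measurable

variable {Ω : Type*} [MeasurableSpace Ω]

/-- The search events `{ω | crossing at W or W = Wmax}` are measurable for a random curve with
measurable coordinates. -/
theorem measurableSet_msCrossOrEnd {τ : ℕ → Ω → ℝ} (hτ : ∀ W, Measurable (τ W)) (c : ℝ) (Wmax W : ℕ) :
    MeasurableSet {ω | msCrossOrEnd c Wmax (fun W' => τ W' ω) W} := by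
  simp only [msCrossOrEnd, Set.setOf_or, Set.setOf_and]
  refine ((MeasurableSet.const _).inter ((MeasurableSet.const _).inter ?_)).union
    (MeasurableSet.const _)
  exact measurableSet_le ((hτ W).const_mul c) measurable_const

open Classical in
/-- **The data-chosen window is a measurable function of the data**: for a random curve
`W ↦ τ̂_W(ω)` with measurable coordinates, `ω ↦ msWindowSel c Wmax (τ̂_·(ω))` is measurable. -/
theorem measurable_msWindowSel {τ : ℕ → Ω → ℝ} (hτ : ∀ W, Measurable (τ W)) (c : ℝ) (Wmax : ℕ) :
    Measurable fun ω => msWindowSel c Wmax (fun W => τ W ω) :=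
  measurable_find (fun ω => exists_msCrossOrEnd c Wmax (fun W => τ W ω))
    (measurableSet_msCrossOrEnd hτ c Wmax)

end Measurable

end Summit.Ventures.LatticeQCDFlow.Scoring

end
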